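import Summits.HodgeConjecture.HodgeConjecture.Theorems.EndoscopicMiddleDegreeOrthogonalEnvelopedHeckeGraphAnalytic
import Literature.Topology.CoveringSpaces.OrbitQuotientCovering
import Mathlib.GroupTheory.Index
import Mathlib.GroupTheory.Coset.Basic

/-!
# Stub `stub_levelDeep_map_hecke` (line `purity-sorted-hecke-envelope` of crux
# `EndoscopicMiddleDegree.OrthogonalEnveloped`, stmt-HodgeConjecture-14300): the Hecke operator read on a
# deeper level

Registered skeleton `Cruxes/OrthogonalEnveloped/Lines/purity_sorted_hecke_envelope.lean` (rev c6-L2, stub H1);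
this is the file `Theorems/EndoscopicMiddleDegreeOrthogonalEnvelopedLevelDeepHecke.lean` of the summit
(`--supports stmt-HodgeConjecture-14300`).

WHAT IS PROVED (`stub_levelDeep_map_hecke`, signature byte-identical with the registered stub). Let
`D : UnitaryBallQuotientDatum p X` be a compact ball quotient datum (`X(ℂ) ≅ Γ \ 𝔹`), `y ∈ U(V)(F)` an
isometry, and `M ⊴ Γ` a normal subgroup of finite index contained in the Hecke level `N_y` (the normal core
of `Γ_y = Γ ∩ y⁻¹Γy`). Then, pulled back to the level cover `M \ 𝔹`, the Hecke operator `T_y` reads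
`π_M^* (T_y x) = [Γ_y : M]⁻¹ Σ_{q ∈ Γ/M} (π_y^M ∘ q)^* x`, where `π_y^M : M[v] ↦ Γ[y v]` is the translated
projection at level `M` (`D.coverMap y`).

HOW (Shimura 1971, §3.1 Prop. 3.1: `Γ y Γ = ⊔ Γ y γ` over `Γ_y \ Γ`, and the count of repetitions when `γ`
runs over a deeper quotient; §8.3 (8.3.2) for the action on cohomology).
* The DEFINING IDENTITY at level `N_y` (`levelProj_map_heckeCorrespondenceAction`, proved in the tree):
  `π_{N_y}^* (T_y x) = [Γ_y : N_y]⁻¹ Σ_{Q ∈ Γ/N_y} (π_y ∘ Q)^* x`.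
* The intermediate projection `r : M \ 𝔹 → N_y \ 𝔹`, `M[b] ↦ N_y[b]` (`levelDeep_exists_intermediateProj`)
  satisfies `π_{N_y} ∘ r = π_M` and `(π_y ∘ (γ N_y)) ∘ r = π_y^M ∘ (γ M)` for `γ ∈ Γ` (both definitional on
  representatives). Pull the defining identity back along `r`.
* Re-index `Σ_{q ∈ Γ/M}` through `Γ/M ≃ Γ/N_y × N_y/M` (Mathlib `Subgroup.quotientEquivProdOfLE`, whose first
  component is the projection `Γ/M → Γ/N_y`): every fibre has `[N_y : M]` elements, and
  `[Γ_y : M] = [N_y : M] · [Γ_y : N_y]` (`Subgroup.relIndex_mul_relIndex`).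
-/

noncomputable section

-- The crux-workfile namespace `Summit.<P>.<Sub>.Cruxes.…` repeats `HodgeConjecture` (single-conjunct summit).
set_option linter.dupNamespace false

namespace Summit.HodgeConjecture.HodgeConjecture.Cruxes.OrthogonalEnveloped.PuritySortedHeckeEnvelope

open scoped BigOperators
open CategoryTheory
open Literature.AlgebraicGeometry.Motives (SchemeOver ComplexPoints IsSmoothProjective)
open Literature.AlgebraicGeometry.HodgeTheory
open Literature.AlgebraicGeometry.ShimuraVarieties
open Literature.AlgebraicTopology.SingularHomology
open Literature.Topology.CoveringSpaces
open Summit.HodgeConjecture.HodgeConjecture.Cruxes.OrthogonalEnveloped.HeckeGraphChow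
  (isHeckeAdmissible_of_mem_unitaryGroup)

variable {p : ℕ} {X : SchemeOver ℂ}

/-! ## The intermediate projection `M \ 𝔹 → N_y \ 𝔹` -/

/-- **The intermediate projection between level covers.** For an admissible `y` and a normal subgroup
`M ≤ N_y` of `Γ` there is a continuous map `r : M \ 𝔹 → N_y \ 𝔹`, `M[b] ↦ N_y[b]`, over `X(ℂ)`
(`π_{N_y} ∘ r = π_M`) and intertwining the translated projections composed with the deck transformations:
`(π_y ∘ (γ N_y)) ∘ r = π_y^M ∘ (γ M)` for every `γ ∈ Γ` (both sides send `M[b]` to `Γ[y γ b]`).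
[cite: Shimura1973, §3.1 Prop. 3.1 and Ch. 7 §7.2] -/
theorem levelDeep_exists_intermediateProj (D : UnitaryBallQuotientDatum p X) {y : GL (Fin (p + 1)) D.E}
    (h : D.IsHeckeAdmissible y) (M : Subgroup ↥D.Γ) [M.Normal] (hM : M ≤ D.heckeLevel y)
    (hMy : ∀ γ ∈ M, y * (γ : GL (Fin (p + 1)) D.E) * y⁻¹ ∈ D.Γ) :
    ∃ r : C(D.LevelCover M, D.LevelCover (D.heckeLevel y)),
      (D.levelProj (D.heckeLevel y)).comp r = D.levelProj M ∧
      ∀ γ : ↥D.Γ,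
        (h.twist.comp ⟨fun e : D.LevelCover (D.heckeLevel y) ↦
            (QuotientGroup.mk γ : ↥D.Γ ⧸ D.heckeLevel y) • e, continuous_const_smul _⟩).comp r =
          (D.coverMap y h.mem_unitaryGroup hMy).comp
            ⟨fun e : D.LevelCover M ↦ (QuotientGroup.mk γ : ↥D.Γ ⧸ M) • e, continuous_const_smul _⟩ := by
  refine ⟨⟨Quotient.map' id fun b b' hb ↦ ?_, continuous_id.quotient_map' _⟩, ?_, fun γ ↦ ?_⟩
  · obtain ⟨m, rfl⟩ := MulAction.orbitRel_apply.1 hb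
    exact MulAction.orbitRel_apply.2 ⟨⟨(m : ↥D.Γ), hM m.2⟩, rfl⟩
  · refine ContinuousMap.ext fun e ↦ ?_
    induction e using Quotient.inductionOn with
    | h b => rfl
  · refine ContinuousMap.ext fun e ↦ ?_
    induction e using Quotient.inductionOn with
    | h b =>
    induction b using Quotient.inductionOn with
    | h v => rfl

/-! ## The Hecke operator on a deeper level -/

set_option maxHeartbeats 400000 in
/-- **Stub H1 — the Hecke operator read on a deeper level.** For `y ∈ U(V)(F)` and a normal subgroup
`M ⊴ Γ` of finite index contained in the Hecke level `N_y`, pulled back to `M \ 𝔹` the Hecke operator reads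
`π_M^* (T_y x) = [Γ ∩ y⁻¹Γy : M]⁻¹ Σ_{q ∈ Γ/M} (π_y^M ∘ q)^* x` with `π_y^M [v] = Γ[y v]` the translated
projection at level `M` (`D.coverMap y`; any proof `hMy` of `y M y⁻¹ ⊆ Γ`): the defining identity at level `N_y`
(`levelProj_map_heckeCorrespondenceAction`) pulled back along `M \ 𝔹 → N_y \ 𝔹`, `M[v] ↦ N_y[v]`, and re-indexed
over the fibres of `Γ/M → Γ/N_y`, each of size `[N_y : M]` (`[Γ ∩ y⁻¹Γy : M] = [Γ ∩ y⁻¹Γy : N_y] [N_y : M]`).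
[cite: Shimura1973, §3.1 Prop. 3.1 and §8.3 (8.3.2)] -/
theorem stub_levelDeep_map_hecke :
    ∀ {p : ℕ} {X : SchemeOver ℂ} (D : UnitaryBallQuotientDatum p X) (y : GL (Fin (p + 1)) D.E)
      (hy : y ∈ unitaryGroup (conjRingHom D.E) D.H) (M : Subgroup ↥D.Γ) [M.Normal] [M.FiniteIndex]
      (hM : M ≤ D.heckeLevel y) (hMy : ∀ γ ∈ M, y * (γ : GL (Fin (p + 1)) D.E) * y⁻¹ ∈ D.Γ)
      (k : ℕ) (x : complexBetti X k),
      letI : Fintype (↥D.Γ ⧸ M) := Subgroup.fintypeQuotientOfFiniteIndex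
      singularCohomology.map ℂ ℂ (D.levelProj M) k (D.heckeCorrespondenceAction k y x) =
        ((M.relIndex (D.heckeStabilizer y) : ℂ)⁻¹) • ∑ q : ↥D.Γ ⧸ M,
          singularCohomology.map ℂ ℂ
            ((D.coverMap y hy hMy).comp ⟨fun e : D.LevelCover M ↦ q • e, continuous_const_smul q⟩) k x := by
  intro p X D y hy M _ _ hM hMy k x
  letI : Fintype (↥D.Γ ⧸ M) := Subgroup.fintypeQuotientOfFiniteIndex
  have h : D.IsHeckeAdmissible y := isHeckeAdmissible_of_mem_unitaryGroup D hy
  haveI : (D.heckeLevel y).FiniteIndex := h.finiteIndex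
  letI : Fintype (↥D.Γ ⧸ D.heckeLevel y) := Subgroup.fintypeQuotientOfFiniteIndex
  obtain ⟨r, hr1, hr2⟩ := levelDeep_exists_intermediateProj D h M hM hMy
  -- the fibre `N_y / M` of `Γ / M → Γ / N_y` is finite, of cardinality `[N_y : M] ≠ 0`
  have hne : M.relIndex (D.heckeLevel y) ≠ 0 :=
    ne_zero_of_dvd_ne_zero Subgroup.FiniteIndex.index_ne_zero (Subgroup.relIndex_dvd_index_of_le hM)
  haveI : (M.subgroupOf (D.heckeLevel y)).FiniteIndex := ⟨hne⟩
  letI : Fintype (↥(D.heckeLevel y) ⧸ M.subgroupOf (D.heckeLevel y)) :=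
    Subgroup.fintypeQuotientOfFiniteIndex
  -- Step 1: the defining identity at level `N_y`, pulled back along `r`
  have h1 : singularCohomology.map ℂ ℂ (D.levelProj M) k (D.heckeCorrespondenceAction k y x) =
      ((D.heckeIndex y : ℂ)⁻¹) • ∑ Q : ↥D.Γ ⧸ D.heckeLevel y,
        singularCohomology.map ℂ ℂ r k (singularCohomology.map ℂ ℂ
          (h.twist.comp ⟨fun e : D.LevelCover (D.heckeLevel y) ↦ Q • e, continuous_const_smul Q⟩) k x) := by
    rw [← hr1, singularCohomology.map_comp, ModuleCat.comp_apply,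
      D.levelProj_map_heckeCorrespondenceAction h k x, map_smul, map_sum]
  -- Step 2: the summand at `q ∈ Γ / M` is the pulled-back summand at the image of `q` in `Γ / N_y`
  have h2 : ∀ q : ↥D.Γ ⧸ M,
      singularCohomology.map ℂ ℂ
          ((D.coverMap y hy hMy).comp ⟨fun e : D.LevelCover M ↦ q • e, continuous_const_smul q⟩) k x =
        singularCohomology.map ℂ ℂ r k (singularCohomology.map ℂ ℂ
          (h.twist.comp ⟨fun e : D.LevelCover (D.heckeLevel y) ↦
            (Subgroup.quotientEquivProdOfLE hM q).1 • e, continuous_const_smul _⟩) k x) := by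
    intro q
    induction q using QuotientGroup.induction_on with
    | H γ =>
      rw [← ModuleCat.comp_apply, ← singularCohomology.map_comp]
      exact congrArg (fun f ↦ singularCohomology.map ℂ ℂ f k x) (hr2 γ).symm
  -- Step 3: re-index the sum over `Γ / M` through `Γ / M ≃ Γ / N_y × N_y / M`
  have h3 : ∑ q : ↥D.Γ ⧸ M, singularCohomology.map ℂ ℂ
        ((D.coverMap y hy hMy).comp ⟨fun e : D.LevelCover M ↦ q • e, continuous_const_smul q⟩) k x =
      (M.relIndex (D.heckeLevel y) : ℂ) • ∑ Q : ↥D.Γ ⧸ D.heckeLevel y,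
        singularCohomology.map ℂ ℂ r k (singularCohomology.map ℂ ℂ
          (h.twist.comp ⟨fun e : D.LevelCover (D.heckeLevel y) ↦ Q • e, continuous_const_smul Q⟩) k x) := by
    -- summing a function of the first component over `Γ / N_y × N_y / M`
    have aux : ∀ G : ↥D.Γ ⧸ D.heckeLevel y → singularCohomology ℂ ℂ (D.LevelCover M) k,
        ∑ P : (↥D.Γ ⧸ D.heckeLevel y) × (↥(D.heckeLevel y) ⧸ M.subgroupOf (D.heckeLevel y)), G P.1 =
          (M.relIndex (D.heckeLevel y) : ℂ) • ∑ Q : ↥D.Γ ⧸ D.heckeLevel y, G Q := by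
      intro G
      rw [Fintype.sum_prod_type_right]
      dsimp only
      rw [Finset.sum_const, Finset.card_univ, ← Nat.cast_smul_eq_nsmul ℂ, ← Nat.card_eq_fintype_card]
      rfl
    rw [Fintype.sum_equiv (Subgroup.quotientEquivProdOfLE hM)
        (fun q : ↥D.Γ ⧸ M ↦ singularCohomology.map ℂ ℂ
          ((D.coverMap y hy hMy).comp ⟨fun e : D.LevelCover M ↦ q • e, continuous_const_smul q⟩) k x)
        (fun P : (↥D.Γ ⧸ D.heckeLevel y) × (↥(D.heckeLevel y) ⧸ M.subgroupOf (D.heckeLevel y)) ↦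
          singularCohomology.map ℂ ℂ r k (singularCohomology.map ℂ ℂ
            (h.twist.comp ⟨fun e : D.LevelCover (D.heckeLevel y) ↦ P.1 • e, continuous_const_smul _⟩) k x))
        h2]
    exact aux fun Q ↦ singularCohomology.map ℂ ℂ r k (singularCohomology.map ℂ ℂ
      (h.twist.comp ⟨fun e : D.LevelCover (D.heckeLevel y) ↦ Q • e, continuous_const_smul Q⟩) k x)
  -- Step 4: the scalars, `[Γ_y : M] = [N_y : M] [Γ_y : N_y]`
  rw [h1, h3, smul_smul, ← Subgroup.relIndex_mul_relIndex M (D.heckeLevel y) (D.heckeStabilizer y) hM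
    (D.heckeLevel_le y), Nat.cast_mul, mul_inv, mul_right_comm,
    inv_mul_cancel₀ (Nat.cast_ne_zero.2 hne : (M.relIndex (D.heckeLevel y) : ℂ) ≠ 0), one_mul]
  rfl

end Summit.HodgeConjecture.HodgeConjecture.Cruxes.OrthogonalEnveloped.PuritySortedHeckeEnvelope

end
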